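import Summits.CriticalPhenomena.PercolationContinuityZ3.Theorems.PercNearOneGluingNoHeavyLowerTailSahiE3DnfWidthTwo
import Summits.CriticalPhenomena.PercolationContinuityZ3.Theorems.PercNearOneGluingNoHeavyLowerTailSahiE3DnfTwoKahn
import Mathlib.Tactic.FinCases
import HarnessLib
import HarnessLib.Audit

/-!
# `NoHeavyLowerTail` (crux stmt-CriticalPhenomena-4575), Sahi programme P4: KAHN'S CONJECTURE 5 FOR THE FIRST SLOT
# `⋁ᵢ (xᵢ ∧ yᵢ)` (DNF of width two) — the `prodBernoulli` form

Support file (cell `prim-l12`, seat P4, generation 14; `--supports stmt-CriticalPhenomena-4575`).  No named facts, no sorries;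
standard axioms; def-free.

THEOREM `kahn_of_dnf_width2`: for every finite index type `ι`, every `p : ι → [0,1]` (no interior condition), every `n`, distinct
coordinates `v : Fin n × Bool → ι`, and ALL increasing events `A, B ⊆ Set ι`:
  `0 ≤ sahiE3 (prodBernoulli p) {ω | ∃ i, v (i,true) ∈ ω ∧ v (i,false) ∈ ω} A B`
— Kahn's Conjecture 5 [Kahn, arXiv:2210.08653, Conj. 5] when the first increasing event is a disjunction of `n` disjoint dimers
`xᵢ ∧ yᵢ`.  Proof: `…SahiE3DnfWidthTwo.latticeE3_nonneg_of_dnf_width2` on the Boolean lattice `Set ι` with the weight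
`bernoulliWeight p` (pattern marginal `∏ (pᵥ | 1 − pᵥ)`, `…SahiE3DnfTwoKahn.mass_bernoulliWeight_fibre'`) and the bridge
`Literature…sahiE_three_ind`, exactly as `…SahiE3DnfTwoKahn.kahn_of_dnf_two`.  HOME prim-l12-p4/FROM-prim-l12-p4-gen14-DIMER-REDUCTION.md.
-/

namespace Summit.CriticalPhenomena.PercolationContinuityZ3.Theorems.SahiE3DnfWidthTwoKahn

open Finset MeasureTheory Literature.Combinatorics.Sahi2008 Literature.Probability.Percolation
open Literature.Probability.LatticeModels (prodBernoulli sahiE3 mass latticeE3)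

variable {ι : Type*} [Fintype ι]

open scoped Classical in
/-- **Kahn's Conjecture 5 for the first slot `⋁ᵢ (xᵢ ∧ yᵢ)`.**  `ι` finite, `p : ι → [0,1]`, `v : Fin n × Bool → ι` injective;
then for ALL increasing `A, B ⊆ Set ι`: `0 ≤ sahiE3 (prodBernoulli p) {ω | ∃ i, v (i,true) ∈ ω ∧ v (i,false) ∈ ω} A B`. [this work] -/
theorem kahn_of_dnf_width2 (p : ι → unitInterval) (n : ℕ) {v : Fin n × Bool → ι} (hv : Function.Injective v)
    {A B : Set (Set ι)} (hA : IsUpperSet A) (hB : IsUpperSet B) :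
    0 ≤ sahiE3 (prodBernoulli p) {ω : Set ι | ∃ i, v (i, true) ∈ ω ∧ v (i, false) ∈ ω} A B := by
  rw [← sahiE_three_ind]
  have hμ := isFKGMeasure_bernoulliWeight p
  have hA' : IsUpperSet ((A.toFinset : Finset (Set ι)) : Set (Set ι)) := by simpa using hA
  have hB' : IsUpperSet ((B.toFinset : Finset (Set ι)) : Set (Set ι)) := by simpa using hB
  have hF : ∀ (t : Fin n × Bool → Bool) (x : Set ι),
      x ∈ (univ.filter fun x : Set ι => ∀ i, (({v i} : Set ι) ≤ x ↔ t i = true)) ↔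
        ∀ i, (({v i} : Set ι) ≤ x ↔ t i = true) := fun t x => by simp
  have hw : ∀ (i : Fin n × Bool) (c : Bool), 0 ≤ (if c = true then (p (v i) : ℝ) else 1 - (p (v i) : ℝ)) := by
    intro i c
    split_ifs
    · exact unitInterval.nonneg _
    · exact unitInterval.one_minus_nonneg _
  obtain ⟨U', hU'⟩ : ∃ V : Finset (Fin n × Bool → Bool), ∀ t, t ∈ V ↔ ∃ i, t (i, true) = true ∧ t (i, false) = true :=
    ⟨univ.filter fun t => ∃ i, t (i, true) = true ∧ t (i, false) = true, fun t => by simp⟩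
  have key := SahiE3DnfWidthTwo.latticeE3_nonneg_of_dnf_width2 hμ.nonneg hμ.mul_le_mul n
    (fun i => SahiE3MajSlot.supPrime_set_singleton (v i)) hF hA' hB'
    (fun i c => if c = true then (p (v i) : ℝ) else 1 - (p (v i) : ℝ)) hw zero_le_one
    (fun t => by rw [one_mul]; exact SahiE3DnfTwoKahn.mass_bernoulliWeight_fibre' p hv _ t (hF t)) U' hU'
  rw [← sahiE_three_indicator_eq_latticeE3 hμ.sum_eq_one] at key
  refine le_of_le_of_eq key ?_
  congr 1
  funext i
  fin_cases i
  · funext ω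
    simp [setInd_apply, DecisionTree.ind, Set.singleton_subset_iff, hU']
  · funext ω
    simp [setInd_apply, DecisionTree.ind]
  · funext ω
    simp [setInd_apply, DecisionTree.ind]

end Summit.CriticalPhenomena.PercolationContinuityZ3.Theorems.SahiE3DnfWidthTwoKahn
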